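import Summits.QuantumFields.YangMills.Theses.SoftLoopLongLag

/-!
# Route `SoftLoopLongLag` — the Assembly item (stmt-QuantumFields-22505), PROVED:
# `T′ → K′ → P → XiPow` (all compact simple `G`)

HONEST LABEL.  This is the glue of a RECORD-label rung line (rung R2xi-G of LADDER-YM: the leaf
`Summit.QuantumFields.YangMills.Theorems.WeakCouplingRates.XiPow`, «for every compact simple `G` and faithful unitary
lattice representation `r` there is `ε > 0` such that every torus-limit state of the 4-D Wilson theory at `β ≥ β₀` has
RP-spectral mass gap `≤ β^{-ε}`» — an UPPER bound on the mass, i.e. criticality at a power rate).  It is NOT the Clay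
mass gap, proves no summit statement, and touches no OS axiom / continuum limit.

Content (≈ 40 lines, elementary): `K′` applied to `T′` gives, for each `(G, r)`, exponents `ε, q > 0` and a threshold
`β₀` such that for `β ≥ β₀` every torus-limit state `μ` has `β^{-q} ≤ rpCorr μ F ⌈β^ε⌉` and `rpCorr μ F 0 ≤ β^q` for the
cube-smeared soft-loop observable `F`; `P` says `F` is a positive-time observable; the tree's one-distance spectral
bound `HasRPTimeGap.le_log_div` at lag `t = ⌈β^ε⌉` gives `m ≤ log(β^q/β^{-q})/⌈β^ε⌉ = 2q log β/⌈β^ε⌉`, and the log is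
absorbed (`isLittleO_log_rpow_atTop`): `2q log β ≤ β^{ε/2}` eventually, so `m ≤ β^{ε/2}/β^ε = β^{-ε/2}`, i.e.
`MassGapPowerDecayOf 4 r.ρ (ε/2)`; hence `XiPow`.  The measurable structure of `XiPow` (`borel G`) instantiates the
instance binders `[MeasurableSpace G] [BorelSpace G]` of the three items.

Reference for the currency: S. Chatterjee, *Yang–Mills for probabilists*, arXiv:1803.01950, Problem 5.1 (second half,
power-rate form; not in print) — tree `WeakCouplingRatesCurrency`.
-/

set_option autoImplicit false

noncomputable section

open MeasureTheory Filter Topology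
open Literature.MathematicalPhysics Literature.MathematicalPhysics.QuantumFieldTheory
open Literature.MathematicalPhysics.QuantumLattice
open Summit.QuantumFields.YangMills.Theorems.WeakCouplingRates

namespace Summit.QuantumFields.YangMills.Theorems.SoftLoopLongLag

/-- Log absorption: for `a > 0` and any real `c`, eventually `c · log β ≤ β^a`. -/
theorem eventually_mul_log_le_rpow {a : ℝ} (ha : 0 < a) (c : ℝ) :
    ∀ᶠ β : ℝ in atTop, c * Real.log β ≤ β ^ a := by
  have h1 : Tendsto (fun β : ℝ => c * (Real.log β / β ^ a)) atTop (𝓝 (c * 0)) :=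
    ((isLittleO_log_rpow_atTop ha).tendsto_div_nhds_zero).const_mul c
  rw [mul_zero] at h1
  filter_upwards [h1.eventually (eventually_le_nhds zero_lt_one), eventually_gt_atTop 0] with β hβ hβ0
  have hβa : 0 < β ^ a := Real.rpow_pos_of_pos hβ0 a
  have : c * Real.log β / β ^ a ≤ 1 := by rw [mul_div_assoc]; exact hβ
  rwa [div_le_one hβa] at this

/-- The rate bookkeeping of the Assembly: for `ε > 0`, eventually in `β`,
`log(β^q / β^{-q}) / ⌈β^ε⌉₊ ≤ β^{-(ε/2)}`. -/
theorem eventually_log_div_ceil_le_rpow {ε : ℝ} (hε : 0 < ε) (q : ℝ) :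
    ∀ᶠ β : ℝ in atTop, Real.log (β ^ q / β ^ (-q)) / (⌈β ^ ε⌉₊ : ℝ) ≤ β ^ (-(ε / 2)) := by
  have hε2 : 0 < ε / 2 := by linarith
  filter_upwards [eventually_mul_log_le_rpow hε2 (2 * q), eventually_ge_atTop 1] with β hlog hβ1
  have hβ0 : 0 < β := one_pos.trans_le hβ1
  have hβε : 0 < β ^ ε := Real.rpow_pos_of_pos hβ0 ε
  have hceil : β ^ ε ≤ (⌈β ^ ε⌉₊ : ℝ) := Nat.le_ceil _
  have hlogeq : Real.log (β ^ q / β ^ (-q)) = 2 * q * Real.log β := by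
    rw [← Real.rpow_sub hβ0, Real.log_rpow hβ0]
    ring
  rw [hlogeq]
  have htarget : β ^ (ε / 2) / β ^ ε = β ^ (-(ε / 2)) := by
    rw [← Real.rpow_sub hβ0]
    congr 1
    ring
  rcases le_or_gt 0 (2 * q * Real.log β) with hpos | hneg
  · calc 2 * q * Real.log β / (⌈β ^ ε⌉₊ : ℝ) ≤ 2 * q * Real.log β / β ^ ε :=
          div_le_div_of_nonneg_left hpos hβε hceil
      _ ≤ β ^ (ε / 2) / β ^ ε := div_le_div_of_nonneg_right hlog hβε.le
      _ = β ^ (-(ε / 2)) := htarget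
  · exact (div_nonpos_of_nonpos_of_nonneg hneg.le (Nat.cast_nonneg _)).trans (Real.rpow_nonneg hβ0.le _)

/-- **The Assembly item of route `SoftLoopLongLag` (stmt-QuantumFields-22505), PROVED**:
`ColdBoxSoftLoopLagFloor → SoftLoopLagFloorToTorus → SoftLoopObsPosTime → XiPow`.
`K′ hT` gives the torus floor/ceiling `β^{-q} ≤ rpCorr μ F ⌈β^ε⌉`, `rpCorr μ F 0 ≤ β^q`; `P` makes `F` a positive-time
observable; `HasRPTimeGap.le_log_div` at lag `⌈β^ε⌉` and the log absorption give `m ≤ β^{-ε/2}`, i.e.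
`MassGapPowerDecayOf 4 r.ρ (ε/2)` for every compact simple `G` and every `r`.  A rung-level glue (R2xi-G, RECORD label):
an UPPER bound on the lattice mass gap; NOT the Clay mass gap; no summit is proved. -/
theorem assembly_proof : Summit.QuantumFields.YangMills.Theses.SoftLoopLongLag.Assembly := by
  intro hT hK hP G _ _ _ _ hG
  letI : MeasurableSpace G := borel G
  haveI : BorelSpace G := ⟨rfl⟩
  intro r
  obtain ⟨ε, q, β₀, hε, hq, hKr⟩ := hK hT G hG r
  refine ⟨ε / 2, by linarith, ?_⟩
  -- Step 1: the raw rate `log(β^q/β^{-q}) / ⌈β^ε⌉₊` from the one-distance spectral bound at lag `⌈β^ε⌉₊`.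
  have hrate : MassGapUpperRateOf 4 r.ρ (fun β => Real.log (β ^ q / β ^ (-q)) / (⌈β ^ ε⌉₊ : ℕ)) := by
    refine ⟨max β₀ 1, fun β hβ μ hμ m hm => ?_⟩
    have hβ₀ : β₀ ≤ β := (le_max_left _ _).trans hβ
    have hβ1 : (1 : ℝ) ≤ β := (le_max_right _ _).trans hβ
    have hβ0 : 0 < β := one_pos.trans_le hβ1
    have hspec := hKr β hβ₀ μ hμ
    dsimp only at hspec
    obtain ⟨hfloor, hceil⟩ := hspec
    have hposF := hP G r ⌈β ^ ε⌉₊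
    have h1t : 1 ≤ ⌈β ^ ε⌉₊ :=
      Nat.one_le_iff_ne_zero.2 (Nat.pos_iff_ne_zero.1 (Nat.ceil_pos.2 (Real.rpow_pos_of_pos hβ0 ε)))
    exact hm.le_log_div hposF h1t (Real.rpow_pos_of_pos hβ0 _) hfloor hceil
  -- Step 2: log absorption, `log(β^q/β^{-q}) / ⌈β^ε⌉₊ ≤ β^{-ε/2}` eventually.
  exact massGapUpperRateOf_mono r.ρ (eventually_log_div_ceil_le_rpow hε q) hrate

end Summit.QuantumFields.YangMills.Theorems.SoftLoopLongLag

end
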